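import Summits.QuantumFields.YangMills.Theorems.UnitScaleTiltProp7Taylor3Action
import Summits.QuantumFields.YangMills.Theorems.UnitScaleTiltProp7SPrintDefs
import HarnessLib

/-!
# Route `UnitScaleTilt`, crux K1 child «MinimiserStabilityRegPr» (stmt-QuantumFields-19200), skeleton v10, stub `stub_existenceMinimalOrbit`, route (α) GROWTH —
# THE CHART-CURRENCY KNIT: C-min's MINIMALITY CLAUSE FROM CHART_W ∧ EL_W ∧ HESS_W WITH TAYLOR3_W DISCHARGED BY NAME (T3W ✓ p600265), in the two-norm (sup ∕ ℓ²) form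

Cell `ym3-torus`, width seat `ym-ust-19200-w4` (gen 2; OWNER 2026-08-28 03:20:20Z (7): «NEXT = your (1) chart-currency knit `growth142_T3_chart_approxEL` ∘ T3W §6–§7»).
THEOREMS ONLY (0 `def`, 0 `sorry`).  YM₃ on T³ is a ladder rung (R3), not the Clay problem; nothing here claims the stub, the crux, d = 4 or the mass gap.

THE POINT (numbers).  `Prop7Growth142T3Chart.growth142_T3_chart_approxEL` runs the (141)–(142) calculus over ONE abstract norm `‖δ‖`: TAYLOR-3 `≥ −C·ρ·‖δ‖²` on `‖δ‖ ≤ ρ`,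
HESS `≥ κ‖δ‖²`, `C·ρ + λ ≤ κ`.  The PROVED Taylor row (T3W, `Prop7Taylor3Word.abs_wilsonAction4_expChart_sub_taylor2_le`) has TWO scales — the sup radius `s`
(`‖D(b)‖ ≤ s ≤ ¼` bondwise) and the `ℓ²`-size `Σ_b‖D(b)‖²`: `|A(e^{iD}W) − A(W) − ℓ_W(D) − q_W(D)| ≤ 4800·s·Σ_b‖D(b)‖²`.  On `PiLp 2` (`‖δ‖² = Σ_b‖δ(b)‖²`) the abstract
lemma would need either `ρ ≤ s` (then the chart images must have `ℓ²`-norm `≤ s` — a VOLUME-DEPENDENT demand) or `C := 4800s/ρ` with `ρ ≥` every `ℓ²`-norm (finite but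
volume-sized).  So this file runs the same three-line argument DIRECTLY in the two-norm form, in plain function letters (no `PiLp`), consuming T3W by `exact`:
  `A(e^{iD}W) − A(W) = [T3W remainder ≥ −4800s·Σ‖D‖²] + ℓ_W(D) [≥ −λΣ‖D‖², EL_W approx] + q_W(D) [≥ κΣ‖D‖², HESS_W] ≥ (κ − λ − 4800s)·Σ‖D‖² ≥ 0`.
Rows DISPLAYED (function letters, over an abstract slice `T ⊆ (PBond → M₂(ℂ))`): CHART_W (every admissible competitor `X′` of C-min's ball is `A(e^{iX′}U₀) = A(e^{iD}W)` for some
`D ∈ T`, Hermitian-traceless, `‖D(b)‖ ≤ s`; `A(W) = A(e^{iX}U₀)`), EL_W (`|ℓ_W(D)| ≤ λ·Σ_b‖D(b)‖²` on `T` — Prop 6's equation on the tangent directions + the multiplier term),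
HESS_W (`κ·Σ_b‖D(b)‖² ≤ q_W(D)` on `T`).  §3 is the MIXED-currency twin through T3W §7 (`abs_lin_pertY_sub_lin_chart_le`): growth in p1's `Y`-letters at the chart competitor
(`rate·Σ‖Y‖² ≤ A(e^{iD}W) − A(W) − Lin_W(Y)`, the shape of p1's models) + EL_W in `D`-letters ⟹ minimality when `(9/16)·rate ≥ 12a + λ` (`‖Y(b)‖ ≥ ¾‖D(b)‖` for `‖D(b)‖ ≤ ¼`).

WHAT IS PROVED (ns `…Theorems.Prop7Growth142T3ChartKnit`).  §1 `norm_pertY_ge`, `sum_norm_pertY_sq_ge` (`(9/16)Σ‖D‖² ≤ Σ‖Y‖²`); §2 ★ `cmin_minimality_of_chartRows`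
(CHART_W ∧ EL_W ∧ HESS_W ∧ `4800s + λ ≤ κ` ⟹ C-min's last clause VERBATIM; TAYLOR3_W by name); §3 ★ `cmin_minimality_of_chartYRows` (CHART_W ∧ GROWTH-Y ∧ EL_W ∧
`12a + λ ≤ (9/16)·rate` ⟹ the same; T3W §7 by name).

HONEST SCOPE.  Bookkeeping over T3W; the displayed rows carry [Balaban1985Variational] Sect. E's content at the critical point ((47)–(48) covering, Prop. 6, (116));
`--supports stmt-QuantumFields-19200`, count-neutral.

References: T. Bałaban, CMP 102 (1985) 277–309 [Balaban1985Variational] ((141)–(142) p.299, (47)–(48) p.285, Prop. 6 p.295, (116) p.295, (19)–(21) p.281).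
-/

set_option autoImplicit false

noncomputable section

open scoped BigOperators Matrix.Norms.L2Operator Matrix

namespace Summit.QuantumFields.YangMills.Theorems.Prop7Growth142T3ChartKnit

open Literature.MathematicalPhysics.QuantumFieldTheory.Balaban1983to89
open Literature.MathematicalPhysics.QuantumFieldTheory.Balaban1983to89.T3ContinuumYM3Torus
open Literature.MathematicalPhysics.QuantumFieldTheory.Balaban1983to89.T3SectALandauChart (emb15)
open Summit.QuantumFields.YangMills.Theorems.Prop7TPrint (nMax19 expHermField)
open Summit.QuantumFields.YangMills.Theorems.Prop7SPrint (AvgCondPrint IsLandauPrint)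
open Summit.QuantumFields.YangMills.Theorems.Prop7Taylor3ExpChart (norm_I_smul norm_pertY_sub_lin_le)
open Summit.QuantumFields.YangMills.Theorems.Prop7Taylor3Word (neg_le_wilsonAction4_expChart_sub_taylor2 abs_lin_pertY_sub_lin_chart_le)

variable {F : T3Family} {K : ℕ}

/-! ## §1 The chart is bi-Lipschitz on the quarter ball: `‖Y(b)‖ ≥ ¾‖D(b)‖` -/

/-- `¾‖D(b)‖ ≤ ‖Y(b)‖` for `Y(b) = (e^{iD}W)(b)W(b)^* − 1`, `‖D(b)‖ ≤ ¼` (`‖Y − iD‖ ≤ ‖D‖² ≤ ¼‖D‖`). [cite: Balaban1985Variational, (112) p.294, (19) p.281] -/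
theorem norm_pertY_ge (W : GaugeField (F.P K) 0 (Matrix.specialUnitaryGroup (Fin 2) ℂ)) (D : PBond (F.P K) 0 → Matrix (Fin 2) (Fin 2) ℂ) (b : PBond (F.P K) 0)
    (hD : (D b).IsHermitian ∧ Matrix.trace (D b) = 0) (h4 : ‖D b‖ ≤ 1 / 4) :
    (3 / 4) * ‖D b‖ ≤ ‖(((emb15 W (expHermField D) b : Matrix.specialUnitaryGroup (Fin 2) ℂ) : Matrix (Fin 2) (Fin 2) ℂ) * star (W b : Matrix (Fin 2) (Fin 2) ℂ) - 1)‖ := by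
  have h1 : ‖D b‖ ≤ 1 := h4.trans (by norm_num)
  have hr := norm_pertY_sub_lin_le W D b hD h1
  have hsq : ‖D b‖ ^ 2 ≤ (1 / 4) * ‖D b‖ := by nlinarith [norm_nonneg (D b)]
  have htri : ‖Complex.I • D b‖ ≤ ‖(((emb15 W (expHermField D) b : Matrix.specialUnitaryGroup (Fin 2) ℂ) : Matrix (Fin 2) (Fin 2) ℂ) * star (W b : Matrix (Fin 2) (Fin 2) ℂ) - 1)‖
      + ‖(((emb15 W (expHermField D) b : Matrix.specialUnitaryGroup (Fin 2) ℂ) : Matrix (Fin 2) (Fin 2) ℂ) * star (W b : Matrix (Fin 2) (Fin 2) ℂ) - 1) - Complex.I • D b‖ := by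
    -- `‖x‖ ≤ ‖y‖ + ‖y − x‖`
    calc ‖Complex.I • D b‖ = ‖(((emb15 W (expHermField D) b : Matrix.specialUnitaryGroup (Fin 2) ℂ) : Matrix (Fin 2) (Fin 2) ℂ) * star (W b : Matrix (Fin 2) (Fin 2) ℂ) - 1) - ((((emb15 W (expHermField D) b : Matrix.specialUnitaryGroup (Fin 2) ℂ) : Matrix (Fin 2) (Fin 2) ℂ) * star (W b : Matrix (Fin 2) (Fin 2) ℂ) - 1) - Complex.I • D b)‖ := by rw [sub_sub_cancel]
      _ ≤ _ := norm_sub_le _ _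
  rw [norm_I_smul] at htri
  linarith

/-- **`(9/16)·Σ_b‖D(b)‖² ≤ Σ_b‖Y(b)‖²`** on the quarter ball (squares of `norm_pertY_ge`). [cite: Balaban1985Variational, (112) p.294, (19) p.281] -/
theorem sum_norm_pertY_sq_ge (W : GaugeField (F.P K) 0 (Matrix.specialUnitaryGroup (Fin 2) ℂ)) (D : PBond (F.P K) 0 → Matrix (Fin 2) (Fin 2) ℂ)
    (hD : ∀ b : PBond (F.P K) 0, (D b).IsHermitian ∧ Matrix.trace (D b) = 0) (h4 : ∀ b : PBond (F.P K) 0, ‖D b‖ ≤ 1 / 4) :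
    (9 / 16) * ∑ b : PBond (F.P K) 0, ‖D b‖ ^ 2 ≤ ∑ b : PBond (F.P K) 0, ‖(((emb15 W (expHermField D) b : Matrix.specialUnitaryGroup (Fin 2) ℂ) : Matrix (Fin 2) (Fin 2) ℂ) * star (W b : Matrix (Fin 2) (Fin 2) ℂ) - 1)‖ ^ 2 := by
  rw [Finset.mul_sum]
  refine Finset.sum_le_sum fun b _ => ?_
  have h := norm_pertY_ge W D b (hD b) (h4 b)
  have h0 : 0 ≤ (3 / 4) * ‖D b‖ := by positivity
  nlinarith [h, h0]

/-! ## §2 ★ C-min's minimality clause from CHART_W ∧ EL_W ∧ HESS_W, TAYLOR3_W by name -/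

/-- ★ **THE CHART-CURRENCY KNIT (two-norm form).**  `W` with `A(W) = A(e^{iX}U₀)` (the Prop-6 chart point or any of its gauge transforms); an abstract slice `T` of direction
fields; rows: CHART_W (every admissible `X′` of C-min's `ε₄`-ball has `A(e^{iX′}U₀) = A(e^{iD}W)` for some `D ∈ T`, Hermitian-traceless, `‖D(b)‖ ≤ s`), EL_W
(`|ℓ_W(D)| ≤ λ·Σ_b‖D(b)‖²` on such `D`), HESS_W (`κ·Σ_b‖D(b)‖² ≤ q_W(D)`), and `4800s + λ ≤ κ`, `0 ≤ s`, `4s ≤ 1`.  THEN C-min's last clause holds VERBATIM — TAYLOR3_W is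
`Prop7Taylor3Word.neg_le_wilsonAction4_expChart_sub_taylor2`. [cite: Balaban1985Variational, (141)-(142) p.299, (47)-(48) p.285, Prop. 6 p.295, (116) p.295] -/
theorem cmin_minimality_of_chartRows (F : T3Family) {n K : ℕ} (hnK : n < K) {ε₄ s lam κ : ℝ}
    (V : GaugeField (F.P n) 0 (Matrix.specialUnitaryGroup (Fin 2) ℂ)) (U₀ W : GaugeField (F.P K) 0 (Matrix.specialUnitaryGroup (Fin 2) ℂ))
    (X : PBond (F.P K) 0 → Matrix (Fin 2) (Fin 2) ℂ) (T : Set (PBond (F.P K) 0 → Matrix (Fin 2) (Fin 2) ℂ))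
    (hCHART : ∀ X' : PBond (F.P K) 0 → Matrix (Fin 2) (Fin 2) ℂ, nMax19 F n K U₀ X' < ε₄ →
      (∀ b : PBond (F.P K) 0, (X' b).IsHermitian ∧ Matrix.trace (X' b) = 0) →
        AvgCondPrint F n K hnK.le V U₀ X' → IsLandauPrint F n K U₀ X' →
          ∃ D ∈ T, (∀ b : PBond (F.P K) 0, (D b).IsHermitian ∧ Matrix.trace (D b) = 0) ∧ (∀ b : PBond (F.P K) 0, ‖D b‖ ≤ s) ∧
            wilsonAction4 (emb15 U₀ (expHermField X')) = wilsonAction4 (emb15 W (expHermField D)))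
    (hcentre : wilsonAction4 W = wilsonAction4 (emb15 U₀ (expHermField X)))
    (hEL : ∀ D ∈ T, (∀ b : PBond (F.P K) 0, (D b).IsHermitian ∧ Matrix.trace (D b) = 0) → (∀ b : PBond (F.P K) 0, ‖D b‖ ≤ s) →
      |∑ p : Plaq (F.P K) 0, (1 / 2) * (((((GaugeField.plaqHol W p : Matrix.specialUnitaryGroup (Fin 2) ℂ) : Matrix (Fin 2) (Fin 2) ℂ) - 1)ᴴ * (((Complex.I • D ⟨p.src, p.μ⟩) + ((W ⟨p.src, p.μ⟩ : Matrix (Fin 2) (Fin 2) ℂ) * (Complex.I • D ⟨p.src.shift p.μ, p.ν⟩) * star (W ⟨p.src, p.μ⟩ : Matrix (Fin 2) (Fin 2) ℂ))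
            - (((W ⟨p.src, p.μ⟩ * W ⟨p.src.shift p.μ, p.ν⟩ * (W ⟨p.src.shift p.ν, p.μ⟩)⁻¹ : Matrix.specialUnitaryGroup (Fin 2) ℂ) : Matrix (Fin 2) (Fin 2) ℂ) * (Complex.I • D ⟨p.src.shift p.ν, p.μ⟩) * star ((W ⟨p.src, p.μ⟩ * W ⟨p.src.shift p.μ, p.ν⟩ * (W ⟨p.src.shift p.ν, p.μ⟩)⁻¹ : Matrix.specialUnitaryGroup (Fin 2) ℂ) : Matrix (Fin 2) (Fin 2) ℂ))
            - (((GaugeField.plaqHol W p : Matrix.specialUnitaryGroup (Fin 2) ℂ) : Matrix (Fin 2) (Fin 2) ℂ) * (Complex.I • D ⟨p.src, p.ν⟩) * star ((GaugeField.plaqHol W p : Matrix.specialUnitaryGroup (Fin 2) ℂ) : Matrix (Fin 2) (Fin 2) ℂ))) * ((GaugeField.plaqHol W p : Matrix.specialUnitaryGroup (Fin 2) ℂ) : Matrix (Fin 2) (Fin 2) ℂ))).trace).re|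
        ≤ lam * ∑ b : PBond (F.P K) 0, ‖D b‖ ^ 2)
    (hq : ∀ D ∈ T, (∀ b : PBond (F.P K) 0, (D b).IsHermitian ∧ Matrix.trace (D b) = 0) → (∀ b : PBond (F.P K) 0, ‖D b‖ ≤ s) →
      κ * ∑ b : PBond (F.P K) 0, ‖D b‖ ^ 2
        ≤ ∑ p : Plaq (F.P K) 0, ((1 / 2) * ‖((Complex.I • D ⟨p.src, p.μ⟩) + ((W ⟨p.src, p.μ⟩ : Matrix (Fin 2) (Fin 2) ℂ) * (Complex.I • D ⟨p.src.shift p.μ, p.ν⟩) * star (W ⟨p.src, p.μ⟩ : Matrix (Fin 2) (Fin 2) ℂ))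
            - (((W ⟨p.src, p.μ⟩ * W ⟨p.src.shift p.μ, p.ν⟩ * (W ⟨p.src.shift p.ν, p.μ⟩)⁻¹ : Matrix.specialUnitaryGroup (Fin 2) ℂ) : Matrix (Fin 2) (Fin 2) ℂ) * (Complex.I • D ⟨p.src.shift p.ν, p.μ⟩) * star ((W ⟨p.src, p.μ⟩ * W ⟨p.src.shift p.μ, p.ν⟩ * (W ⟨p.src.shift p.ν, p.μ⟩)⁻¹ : Matrix.specialUnitaryGroup (Fin 2) ℂ) : Matrix (Fin 2) (Fin 2) ℂ))
            - (((GaugeField.plaqHol W p : Matrix.specialUnitaryGroup (Fin 2) ℂ) : Matrix (Fin 2) (Fin 2) ℂ) * (Complex.I • D ⟨p.src, p.ν⟩) * star ((GaugeField.plaqHol W p : Matrix.specialUnitaryGroup (Fin 2) ℂ) : Matrix (Fin 2) (Fin 2) ℂ)))‖ ^ 2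
          + (1 / 2) * (((((GaugeField.plaqHol W p : Matrix.specialUnitaryGroup (Fin 2) ℂ) : Matrix (Fin 2) (Fin 2) ℂ) - 1)ᴴ * (((2 : ℂ)⁻¹ • ((Complex.I • D ⟨p.src, p.μ⟩) ^ 2 + ((W ⟨p.src, p.μ⟩ : Matrix (Fin 2) (Fin 2) ℂ) * (Complex.I • D ⟨p.src.shift p.μ, p.ν⟩) * star (W ⟨p.src, p.μ⟩ : Matrix (Fin 2) (Fin 2) ℂ)) ^ 2
              + (((W ⟨p.src, p.μ⟩ * W ⟨p.src.shift p.μ, p.ν⟩ * (W ⟨p.src.shift p.ν, p.μ⟩)⁻¹ : Matrix.specialUnitaryGroup (Fin 2) ℂ) : Matrix (Fin 2) (Fin 2) ℂ) * (Complex.I • D ⟨p.src.shift p.ν, p.μ⟩) * star ((W ⟨p.src, p.μ⟩ * W ⟨p.src.shift p.μ, p.ν⟩ * (W ⟨p.src.shift p.ν, p.μ⟩)⁻¹ : Matrix.specialUnitaryGroup (Fin 2) ℂ) : Matrix (Fin 2) (Fin 2) ℂ)) ^ 2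
              + (((GaugeField.plaqHol W p : Matrix.specialUnitaryGroup (Fin 2) ℂ) : Matrix (Fin 2) (Fin 2) ℂ) * (Complex.I • D ⟨p.src, p.ν⟩) * star ((GaugeField.plaqHol W p : Matrix.specialUnitaryGroup (Fin 2) ℂ) : Matrix (Fin 2) (Fin 2) ℂ)) ^ 2)
            + (Complex.I • D ⟨p.src, p.μ⟩) * ((W ⟨p.src, p.μ⟩ : Matrix (Fin 2) (Fin 2) ℂ) * (Complex.I • D ⟨p.src.shift p.μ, p.ν⟩) * star (W ⟨p.src, p.μ⟩ : Matrix (Fin 2) (Fin 2) ℂ))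
            - (Complex.I • D ⟨p.src, p.μ⟩) * (((W ⟨p.src, p.μ⟩ * W ⟨p.src.shift p.μ, p.ν⟩ * (W ⟨p.src.shift p.ν, p.μ⟩)⁻¹ : Matrix.specialUnitaryGroup (Fin 2) ℂ) : Matrix (Fin 2) (Fin 2) ℂ) * (Complex.I • D ⟨p.src.shift p.ν, p.μ⟩) * star ((W ⟨p.src, p.μ⟩ * W ⟨p.src.shift p.μ, p.ν⟩ * (W ⟨p.src.shift p.ν, p.μ⟩)⁻¹ : Matrix.specialUnitaryGroup (Fin 2) ℂ) : Matrix (Fin 2) (Fin 2) ℂ))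
            - (Complex.I • D ⟨p.src, p.μ⟩) * (((GaugeField.plaqHol W p : Matrix.specialUnitaryGroup (Fin 2) ℂ) : Matrix (Fin 2) (Fin 2) ℂ) * (Complex.I • D ⟨p.src, p.ν⟩) * star ((GaugeField.plaqHol W p : Matrix.specialUnitaryGroup (Fin 2) ℂ) : Matrix (Fin 2) (Fin 2) ℂ))
            - ((W ⟨p.src, p.μ⟩ : Matrix (Fin 2) (Fin 2) ℂ) * (Complex.I • D ⟨p.src.shift p.μ, p.ν⟩) * star (W ⟨p.src, p.μ⟩ : Matrix (Fin 2) (Fin 2) ℂ))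
                * (((W ⟨p.src, p.μ⟩ * W ⟨p.src.shift p.μ, p.ν⟩ * (W ⟨p.src.shift p.ν, p.μ⟩)⁻¹ : Matrix.specialUnitaryGroup (Fin 2) ℂ) : Matrix (Fin 2) (Fin 2) ℂ) * (Complex.I • D ⟨p.src.shift p.ν, p.μ⟩) * star ((W ⟨p.src, p.μ⟩ * W ⟨p.src.shift p.μ, p.ν⟩ * (W ⟨p.src.shift p.ν, p.μ⟩)⁻¹ : Matrix.specialUnitaryGroup (Fin 2) ℂ) : Matrix (Fin 2) (Fin 2) ℂ))
            - ((W ⟨p.src, p.μ⟩ : Matrix (Fin 2) (Fin 2) ℂ) * (Complex.I • D ⟨p.src.shift p.μ, p.ν⟩) * star (W ⟨p.src, p.μ⟩ : Matrix (Fin 2) (Fin 2) ℂ))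
                * (((GaugeField.plaqHol W p : Matrix.specialUnitaryGroup (Fin 2) ℂ) : Matrix (Fin 2) (Fin 2) ℂ) * (Complex.I • D ⟨p.src, p.ν⟩) * star ((GaugeField.plaqHol W p : Matrix.specialUnitaryGroup (Fin 2) ℂ) : Matrix (Fin 2) (Fin 2) ℂ))
            + (((W ⟨p.src, p.μ⟩ * W ⟨p.src.shift p.μ, p.ν⟩ * (W ⟨p.src.shift p.ν, p.μ⟩)⁻¹ : Matrix.specialUnitaryGroup (Fin 2) ℂ) : Matrix (Fin 2) (Fin 2) ℂ) * (Complex.I • D ⟨p.src.shift p.ν, p.μ⟩) * star ((W ⟨p.src, p.μ⟩ * W ⟨p.src.shift p.μ, p.ν⟩ * (W ⟨p.src.shift p.ν, p.μ⟩)⁻¹ : Matrix.specialUnitaryGroup (Fin 2) ℂ) : Matrix (Fin 2) (Fin 2) ℂ))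
                * (((GaugeField.plaqHol W p : Matrix.specialUnitaryGroup (Fin 2) ℂ) : Matrix (Fin 2) (Fin 2) ℂ) * (Complex.I • D ⟨p.src, p.ν⟩) * star ((GaugeField.plaqHol W p : Matrix.specialUnitaryGroup (Fin 2) ℂ) : Matrix (Fin 2) (Fin 2) ℂ))) * ((GaugeField.plaqHol W p : Matrix.specialUnitaryGroup (Fin 2) ℂ) : Matrix (Fin 2) (Fin 2) ℂ))).trace).re))
    (hs0 : 0 ≤ s) (hs4 : 4 * s ≤ 1) (hκ : 4800 * s + lam ≤ κ) :
    ∀ X' : PBond (F.P K) 0 → Matrix (Fin 2) (Fin 2) ℂ, nMax19 F n K U₀ X' < ε₄ →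
      (∀ b : PBond (F.P K) 0, (X' b).IsHermitian ∧ Matrix.trace (X' b) = 0) →
        AvgCondPrint F n K hnK.le V U₀ X' → IsLandauPrint F n K U₀ X' →
          wilsonAction4 (emb15 U₀ (expHermField X)) ≤ wilsonAction4 (emb15 U₀ (expHermField X')) := by
  intro X' hX'ε hX'h h20' h21'
  obtain ⟨D, hDT, hDh, hDs, hA⟩ := hCHART X' hX'ε hX'h h20' h21'
  rw [hA, ← hcentre]
  have hT := neg_le_wilsonAction4_expChart_sub_taylor2 W D hDh hs0 hDs hs4
  have h1 := (abs_le.mp (hEL D hDT hDh hDs)).1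
  have h2 := hq D hDT hDh hDs
  have hS0 : 0 ≤ ∑ b : PBond (F.P K) 0, ‖D b‖ ^ 2 := Finset.sum_nonneg fun _ _ => sq_nonneg _
  have h3 : 0 ≤ (κ - lam - 4800 * s) * ∑ b : PBond (F.P K) 0, ‖D b‖ ^ 2 := mul_nonneg (by linarith) hS0
  nlinarith [hT, h1, h2, h3]

/-! ## §3 ★ The mixed-currency twin: growth in p1's `Y`-letters at the chart competitor, EL_W in chart letters (T3W §7 by name) -/

/-- ★ **THE MIXED-CURRENCY KNIT.**  As `cmin_minimality_of_chartRows`, with HESS_W ∧ TAYLOR3_W replaced by a GROWTH row in p1's `Y`-currency at the chart competitor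
(`rate·Σ_b‖Y(b)‖² ≤ A(e^{iD}W) − A(W) − Lin_W(Y)`, `Y(b) = (e^{iD}W)(b)W(b)^* − 1` — the shape of `Prop7CovariantCoercivity.wilsonAction4_sub_background_ge_offKernel(_divPen)_T3`
at the representative of record) and EL_W kept in chart letters (`|ℓ_W(D)| ≤ λΣ‖D‖²`); background plaquettes within `a` of `1`; smallness `12a + λ ≤ (9/16)·rate`.  The
junction `|Lin_W(Y) − ℓ_W(D)| ≤ 12a·Σ‖D‖²` is T3W §7. [cite: Balaban1985Variational, (141)-(143) p.299, Prop. 6 p.295] -/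
theorem cmin_minimality_of_chartYRows (F : T3Family) {n K : ℕ} (hnK : n < K) {ε₄ s lam rate a : ℝ}
    (V : GaugeField (F.P n) 0 (Matrix.specialUnitaryGroup (Fin 2) ℂ)) (U₀ W : GaugeField (F.P K) 0 (Matrix.specialUnitaryGroup (Fin 2) ℂ))
    (X : PBond (F.P K) 0 → Matrix (Fin 2) (Fin 2) ℂ) (T : Set (PBond (F.P K) 0 → Matrix (Fin 2) (Fin 2) ℂ))
    (ha : 0 ≤ a) (hW : ∀ p : Plaq (F.P K) 0, ‖((GaugeField.plaqHol W p : Matrix.specialUnitaryGroup (Fin 2) ℂ) : Matrix (Fin 2) (Fin 2) ℂ) - 1‖ ≤ a)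
    (hCHART : ∀ X' : PBond (F.P K) 0 → Matrix (Fin 2) (Fin 2) ℂ, nMax19 F n K U₀ X' < ε₄ →
      (∀ b : PBond (F.P K) 0, (X' b).IsHermitian ∧ Matrix.trace (X' b) = 0) →
        AvgCondPrint F n K hnK.le V U₀ X' → IsLandauPrint F n K U₀ X' →
          ∃ D ∈ T, (∀ b : PBond (F.P K) 0, (D b).IsHermitian ∧ Matrix.trace (D b) = 0) ∧ (∀ b : PBond (F.P K) 0, ‖D b‖ ≤ s) ∧
            wilsonAction4 (emb15 U₀ (expHermField X')) = wilsonAction4 (emb15 W (expHermField D)))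
    (hcentre : wilsonAction4 W = wilsonAction4 (emb15 U₀ (expHermField X)))
    (hGrowthY : ∀ D ∈ T, (∀ b : PBond (F.P K) 0, (D b).IsHermitian ∧ Matrix.trace (D b) = 0) → (∀ b : PBond (F.P K) 0, ‖D b‖ ≤ s) →
      rate * ∑ b : PBond (F.P K) 0, ‖(((emb15 W (expHermField D) b : Matrix.specialUnitaryGroup (Fin 2) ℂ) : Matrix (Fin 2) (Fin 2) ℂ) * star (W b : Matrix (Fin 2) (Fin 2) ℂ) - 1)‖ ^ 2
        ≤ wilsonAction4 (emb15 W (expHermField D)) - wilsonAction4 W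
          - ∑ p : Plaq (F.P K) 0, (1 / 2) * (((((GaugeField.plaqHol W p : Matrix.specialUnitaryGroup (Fin 2) ℂ) : Matrix (Fin 2) (Fin 2) ℂ) - 1)ᴴ * (((((emb15 W (expHermField D) ⟨p.src, p.μ⟩ : Matrix.specialUnitaryGroup (Fin 2) ℂ) : Matrix (Fin 2) (Fin 2) ℂ) * star (W ⟨p.src, p.μ⟩ : Matrix (Fin 2) (Fin 2) ℂ) - 1)
              + (W ⟨p.src, p.μ⟩ : Matrix (Fin 2) (Fin 2) ℂ) * (((emb15 W (expHermField D) ⟨p.src.shift p.μ, p.ν⟩ : Matrix.specialUnitaryGroup (Fin 2) ℂ) : Matrix (Fin 2) (Fin 2) ℂ) * star (W ⟨p.src.shift p.μ, p.ν⟩ : Matrix (Fin 2) (Fin 2) ℂ) - 1) * star (W ⟨p.src, p.μ⟩ : Matrix (Fin 2) (Fin 2) ℂ)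
              - ((W ⟨p.src, p.μ⟩ * W ⟨p.src.shift p.μ, p.ν⟩ * (W ⟨p.src.shift p.ν, p.μ⟩)⁻¹ : Matrix.specialUnitaryGroup (Fin 2) ℂ) : Matrix (Fin 2) (Fin 2) ℂ) * (((emb15 W (expHermField D) ⟨p.src.shift p.ν, p.μ⟩ : Matrix.specialUnitaryGroup (Fin 2) ℂ) : Matrix (Fin 2) (Fin 2) ℂ) * star (W ⟨p.src.shift p.ν, p.μ⟩ : Matrix (Fin 2) (Fin 2) ℂ) - 1)
                  * star ((W ⟨p.src, p.μ⟩ * W ⟨p.src.shift p.μ, p.ν⟩ * (W ⟨p.src.shift p.ν, p.μ⟩)⁻¹ : Matrix.specialUnitaryGroup (Fin 2) ℂ) : Matrix (Fin 2) (Fin 2) ℂ)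
              - ((GaugeField.plaqHol W p : Matrix.specialUnitaryGroup (Fin 2) ℂ) : Matrix (Fin 2) (Fin 2) ℂ) * (((emb15 W (expHermField D) ⟨p.src, p.ν⟩ : Matrix.specialUnitaryGroup (Fin 2) ℂ) : Matrix (Fin 2) (Fin 2) ℂ) * star (W ⟨p.src, p.ν⟩ : Matrix (Fin 2) (Fin 2) ℂ) - 1) * star ((GaugeField.plaqHol W p : Matrix.specialUnitaryGroup (Fin 2) ℂ) : Matrix (Fin 2) (Fin 2) ℂ)) * ((GaugeField.plaqHol W p : Matrix.specialUnitaryGroup (Fin 2) ℂ) : Matrix (Fin 2) (Fin 2) ℂ))).trace).re)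
    (hEL : ∀ D ∈ T, (∀ b : PBond (F.P K) 0, (D b).IsHermitian ∧ Matrix.trace (D b) = 0) → (∀ b : PBond (F.P K) 0, ‖D b‖ ≤ s) →
      |∑ p : Plaq (F.P K) 0, (1 / 2) * (((((GaugeField.plaqHol W p : Matrix.specialUnitaryGroup (Fin 2) ℂ) : Matrix (Fin 2) (Fin 2) ℂ) - 1)ᴴ * (((Complex.I • D ⟨p.src, p.μ⟩) + ((W ⟨p.src, p.μ⟩ : Matrix (Fin 2) (Fin 2) ℂ) * (Complex.I • D ⟨p.src.shift p.μ, p.ν⟩) * star (W ⟨p.src, p.μ⟩ : Matrix (Fin 2) (Fin 2) ℂ))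
            - (((W ⟨p.src, p.μ⟩ * W ⟨p.src.shift p.μ, p.ν⟩ * (W ⟨p.src.shift p.ν, p.μ⟩)⁻¹ : Matrix.specialUnitaryGroup (Fin 2) ℂ) : Matrix (Fin 2) (Fin 2) ℂ) * (Complex.I • D ⟨p.src.shift p.ν, p.μ⟩) * star ((W ⟨p.src, p.μ⟩ * W ⟨p.src.shift p.μ, p.ν⟩ * (W ⟨p.src.shift p.ν, p.μ⟩)⁻¹ : Matrix.specialUnitaryGroup (Fin 2) ℂ) : Matrix (Fin 2) (Fin 2) ℂ))
            - (((GaugeField.plaqHol W p : Matrix.specialUnitaryGroup (Fin 2) ℂ) : Matrix (Fin 2) (Fin 2) ℂ) * (Complex.I • D ⟨p.src, p.ν⟩) * star ((GaugeField.plaqHol W p : Matrix.specialUnitaryGroup (Fin 2) ℂ) : Matrix (Fin 2) (Fin 2) ℂ))) * ((GaugeField.plaqHol W p : Matrix.specialUnitaryGroup (Fin 2) ℂ) : Matrix (Fin 2) (Fin 2) ℂ))).trace).re|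
        ≤ lam * ∑ b : PBond (F.P K) 0, ‖D b‖ ^ 2)
    (hs4 : 4 * s ≤ 1) (hrate : 0 ≤ rate) (hκ : 12 * a + lam ≤ (9 / 16) * rate) :
    ∀ X' : PBond (F.P K) 0 → Matrix (Fin 2) (Fin 2) ℂ, nMax19 F n K U₀ X' < ε₄ →
      (∀ b : PBond (F.P K) 0, (X' b).IsHermitian ∧ Matrix.trace (X' b) = 0) →
        AvgCondPrint F n K hnK.le V U₀ X' → IsLandauPrint F n K U₀ X' →
          wilsonAction4 (emb15 U₀ (expHermField X)) ≤ wilsonAction4 (emb15 U₀ (expHermField X')) := by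
  intro X' hX'ε hX'h h20' h21'
  obtain ⟨D, hDT, hDh, hDs, hA⟩ := hCHART X' hX'ε hX'h h20' h21'
  rw [hA, ← hcentre]
  have h4 : ∀ b : PBond (F.P K) 0, ‖D b‖ ≤ 1 / 4 := fun b => (hDs b).trans (by linarith)
  have h1 : ∀ b : PBond (F.P K) 0, ‖D b‖ ≤ 1 := fun b => (h4 b).trans (by norm_num)
  have hG := hGrowthY D hDT hDh hDs
  have hJ := (abs_le.mp (abs_lin_pertY_sub_lin_chart_le W D hDh h1 ha hW)).1
  have hE := (abs_le.mp (hEL D hDT hDh hDs)).1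
  have hYD := sum_norm_pertY_sq_ge W D hDh h4
  have hS0 : 0 ≤ ∑ b : PBond (F.P K) 0, ‖D b‖ ^ 2 := Finset.sum_nonneg fun _ _ => sq_nonneg _
  have h3 : 0 ≤ ((9 / 16) * rate - 12 * a - lam) * ∑ b : PBond (F.P K) 0, ‖D b‖ ^ 2 := mul_nonneg (by linarith) hS0
  have hr := mul_le_mul_of_nonneg_left hYD hrate
  nlinarith [hG, hJ, hE, h3, hr]

end Summit.QuantumFields.YangMills.Theorems.Prop7Growth142T3ChartKnit

end
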